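import Mathlib
import Summits.KontsevichZagierPeriods.Zeta5Search.CellKitBlocks
import HarnessLib

/-!
# ζ(5) search — CELL KIT, part 3: the ORIGIN / ZERO theorems (generic LB♯♯ assembly), digit-free conclusions

Cell `pub-zeta5` (HONEST FRAMING: systematic search; no irrationality claim unless certified), P1 prover seat generation 7.
The assembly behind P1 g5/g6's record cells A, C, D, E, F made GENERIC in the vector `b` (any point of the polytope with
`b + e_j` in the polytope), the direction `j`, the window prime `p` and the level `m ≤ −4`:
let every residue class have class exponent `E_x ≥ m` and let the LEVEL-`m` CLASSES (`E_x = m`) avoid the centre.  With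
`x̄ = conjClass b p x`, `ε = (−1)^{m+1}` and the PAIR VECTOR `(α_x, β_x) = (ŵ_x + ε ŵ_x̄, v̂_x + ε v̂_x̄)` (written out; no new definitions):
* **origin** (`origin_bound`): if the pair vectors of the level-`m` classes are collinear through the origin
  (`α_x β_y = α_y β_x`), then `v_p(Cas_j(b)) ≥ (3 + 2m) + 1`;
* **zero** (`zero_bound`, `zero_bound_WV`): if they all vanish, `v_p(Cas_j(b)) ≥ (3 + 2m) + 2`, `v_p(W(b)) ≥ m + 4`, `v_p(V(b)) ≥ m + 1`.
(`3 + 2m` is THEOREM LB's `casLB` on such cells.)  Mechanism (P1 g6): per class the normalised digits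
`(−p)^{−(m+3)}W_x ≡ ĝ_x ŵ_x`, `(−p)^{−m}V_x ≡ ĝ_x v̂_x`, `ĝ_x̄ ≡ ε ĝ_x` (`LevelClassDigits`), so twice the level-`m` block is
`Σ ĝ_x α_x` resp. `Σ ĝ_x β_x`; the other classes are `O(p)` smaller; for `b + e_j` the level-`m` classes are the unhit ones of `b` with the
same pair vectors (`CellKitLevel`), and `Σ_{x,y} ĝ⁺_x ĝ_y (α_x β_y − α_y β_x) = 0`.  Valuations of rationals; nothing about irrationality.
-/

noncomputable section

open Finset

namespace Summit.KontsevichZagierPeriods.Zeta5Search.CellKit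

open Summit.KontsevichZagierPeriods.Zeta5Search.DualSeries (InBox)
open Summit.KontsevichZagierPeriods.Zeta5Search.WedgeDictionary (coeffW coeffV)
open Summit.KontsevichZagierPeriods.Zeta5Search.CasoratianValuation (InPolytope shift casoratian)
open Summit.KontsevichZagierPeriods.Zeta5Search.ClusterValuation (netExp classSet CentreIn classExp classV gHat conjClass
  classSet_shift centreIn_shift classExp_shift_ge le_of_mem_classSet conjClass_lt conjClass_conjClass classExp_conj
  centreIn_conj_iff coeffV_eq_sum_classV val_ge_of_padicNorm_le thmA_data)
open Summit.KontsevichZagierPeriods.Zeta5Search.PadicSeries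
open Summit.KontsevichZagierPeriods.Zeta5Search.BigPrime (shift_zero padicNorm_mul_le_one)
open Summit.KontsevichZagierPeriods.Zeta5Search.CellA (classW wHat vHat coeffW_eq_sum_classW classExp_le_classNu padicNorm_zpow_unit)
open Summit.KontsevichZagierPeriods.Zeta5Search.CellD (padicNorm_classW_le padicNorm_classV_le_of small_of_two_mul)
open Summit.KontsevichZagierPeriods.Zeta5Search.CellC (small_mul_small)
open Summit.KontsevichZagierPeriods.Zeta5Search.LevelClass


/-! No new definitions: the level-`m` set is `(Finset.range p).filter (fun x => classExp b p x = m)`, the pair vector is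
`(ŵ_x + (−1)^{m+1} ŵ_x̄, v̂_x + (−1)^{m+1} v̂_x̄)` written out, the normalised pieces are `(−p)^{−(m+3)} W_x`, `(−p)^{−m} V_x`. -/

variable {p : ℕ} [hp : Fact p.Prime]

/-! ### §5 The theorems -/

section Main

variable (b : ℕ → ℤ) (hb : InPolytope b) {j : ℕ} (hj1 : 1 ≤ j) (hj7 : j ≤ 7) (hb' : InPolytope (shift b j))
  (hp5 : 5 ≤ p) (hwin : (b 0 + 2 : ℤ) < (p : ℤ) ^ 2) (hpN : p ≤ (b 0).toNat)
  {m : ℤ} (hm : m ≤ -4) (hmin : ∀ x, x < p → m ≤ classExp b p x)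
  (hcen : ∀ x, x < p → classExp b p x = m → ¬ CentreIn b p x)

/-- From `‖(−p)^{−a}·X‖ ≤ p^{−k}` to `v_p(X) ≥ a + k`. -/
theorem val_ge_of_normalised {X : ℚ} (hX : X ≠ 0) {a k : ℤ}
    (h : padicNorm p ((-(p : ℚ)) ^ (-a) * X) ≤ (p : ℚ) ^ (-k)) : a + k ≤ padicValRat p X := by
  have hp0 : (p : ℚ) ≠ 0 := Nat.cast_ne_zero.2 hp.out.ne_zero
  apply val_ge_of_padicNorm_le hX
  rw [padicNorm.mul, padicNorm_neg_p_zpow, neg_neg] at h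
  calc padicNorm p X = (p : ℚ) ^ (-a) * ((p : ℚ) ^ a * padicNorm p X) := by
        rw [← mul_assoc, ← zpow_add₀ hp0, neg_add_cancel, zpow_zero, one_mul]
    _ ≤ (p : ℚ) ^ (-a) * (p : ℚ) ^ (-k) := mul_le_mul_of_nonneg_left h (zpow_p_nonneg _)
    _ = (p : ℚ) ^ (-(a + k)) := by rw [← zpow_add₀ hp0]; ring_nf

include hb hj1 hj7 hb' hp5 hwin hpN hm hmin hcen in
/-- **ORIGIN CELLS (generic LB♯♯)**: if all pair vectors of the level-`m` classes are collinear through the origin, then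
`v_p(Cas_j(b)) ≥ (3 + 2m) + 1`. -/
theorem origin_bound
    (hcol : ∀ x ∈ (Finset.filter (fun x => classExp b p x = m) (Finset.range p)), ∀ y ∈ (Finset.filter (fun x => classExp b p x = m) (Finset.range p)), (wHat b p x + (-1 : ℚ) ^ (m + 1) * wHat b p (conjClass b p x)) * (vHat b p y + (-1 : ℚ) ^ (m + 1) * vHat b p (conjClass b p y)) = (wHat b p y + (-1 : ℚ) ^ (m + 1) * wHat b p (conjClass b p y)) * (vHat b p x + (-1 : ℚ) ^ (m + 1) * vHat b p (conjClass b p x)))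
    (hne : casoratian b j ≠ 0) : 3 + 2 * m + 1 ≤ padicValRat p (casoratian b j) := by
  set b' := shift b j with hb'def
  have hwin' : (b' 0 + 2 : ℤ) < (p : ℤ) ^ 2 := by rw [hb'def, shift_zero b hj1]; exact hwin
  have hpN' : p ≤ (b' 0).toNat := by rw [hb'def, shift_zero b hj1]; exact hpN
  have hmin' : ∀ x, x < p → m ≤ classExp b' p x := fun x hx => (hmin x hx).trans (classExp_shift_ge b hb.1 hj1 p x)
  have hcen' : ∀ x, x < p → classExp b' p x = m → ¬ CentreIn b' p x := by
    intro x hx hE h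
    have hxb := (minSet_shift_sub b hb hj1 hj7 hb' hmin (mem_minSet.2 ⟨hx, hE⟩)).1
    exact hcen x hx (mem_minSet.1 hxb).2 ((centreIn_shift b hj1 p x).1 h)
  -- the blocks
  obtain ⟨iA, iB, dA, dB, iGA, iGB⟩ := block_digits b hb hp5 hwin hpN hm hcen
  obtain ⟨iA', iB', dA', dB', iGA', iGB'⟩ := block_digits b' hb' hp5 hwin' hpN' hm hcen'
  obtain ⟨rW, rV⟩ := full_split b hb hp5 hwin hm hmin
  obtain ⟨rW', rV'⟩ := full_split b' hb' hp5 hwin' hm hmin'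
  set A := ∑ x ∈ (Finset.filter (fun x => classExp b p x = m) (Finset.range p)), ((-(p : ℚ)) ^ (-(m + 3)) * classW b p x)
  set B := ∑ x ∈ (Finset.filter (fun x => classExp b p x = m) (Finset.range p)), ((-(p : ℚ)) ^ (-m) * classV b p x)
  set A' := ∑ x ∈ (Finset.filter (fun x => classExp b' p x = m) (Finset.range p)), ((-(p : ℚ)) ^ (-(m + 3)) * classW b' p x)
  set B' := ∑ x ∈ (Finset.filter (fun x => classExp b' p x = m) (Finset.range p)), ((-(p : ℚ)) ^ (-m) * classV b' p x)
  set GA := ∑ x ∈ (Finset.filter (fun x => classExp b p x = m) (Finset.range p)), gHat b p x * (wHat b p x + (-1 : ℚ) ^ (m + 1) * wHat b p (conjClass b p x))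
  set GB := ∑ x ∈ (Finset.filter (fun x => classExp b p x = m) (Finset.range p)), gHat b p x * (vHat b p x + (-1 : ℚ) ^ (m + 1) * vHat b p (conjClass b p x))
  set GA' := ∑ x ∈ (Finset.filter (fun x => classExp b' p x = m) (Finset.range p)), gHat b' p x * (wHat b' p x + (-1 : ℚ) ^ (m + 1) * wHat b' p (conjClass b' p x))
  set GB' := ∑ x ∈ (Finset.filter (fun x => classExp b' p x = m) (Finset.range p)), gHat b' p x * (vHat b' p x + (-1 : ℚ) ^ (m + 1) * vHat b' p (conjClass b' p x))
  set SW := (-(p : ℚ)) ^ (-(m + 3)) * coeffW b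
  set SV := (-(p : ℚ)) ^ (-m) * coeffV b
  set SW' := (-(p : ℚ)) ^ (-(m + 3)) * coeffW b'
  set SV' := (-(p : ℚ)) ^ (-m) * coeffV b'
  -- the key cancellation
  have key : GA' * GB - GA * GB' = 0 := by
    have e1 : GA' * GB - GA * GB' = ∑ x ∈ (Finset.filter (fun x => classExp b' p x = m) (Finset.range p)), ∑ y ∈ (Finset.filter (fun x => classExp b p x = m) (Finset.range p)),
        gHat b' p x * gHat b p y * ((wHat b' p x + (-1 : ℚ) ^ (m + 1) * wHat b' p (conjClass b' p x)) * (vHat b p y + (-1 : ℚ) ^ (m + 1) * vHat b p (conjClass b p y)) - (wHat b p y + (-1 : ℚ) ^ (m + 1) * wHat b p (conjClass b p y)) * (vHat b' p x + (-1 : ℚ) ^ (m + 1) * vHat b' p (conjClass b' p x))) := by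
      have e2 : GA * GB' = ∑ x ∈ (Finset.filter (fun x => classExp b' p x = m) (Finset.range p)), ∑ y ∈ (Finset.filter (fun x => classExp b p x = m) (Finset.range p)),
          (gHat b p y * (wHat b p y + (-1 : ℚ) ^ (m + 1) * wHat b p (conjClass b p y))) * (gHat b' p x * (vHat b' p x + (-1 : ℚ) ^ (m + 1) * vHat b' p (conjClass b' p x))) := by
        simp only [GA, GB']
        rw [sum_mul_sum, sum_comm]
      simp only [GA', GB]
      rw [sum_mul_sum, e2, ← sum_sub_distrib]
      refine sum_congr rfl fun x _ => ?_
      rw [← sum_sub_distrib]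
      exact sum_congr rfl fun y _ => by ring
    rw [e1]
    refine sum_eq_zero fun x hx => sum_eq_zero fun y hy => ?_
    obtain ⟨pw, pv⟩ := pair_shift_eq b hb hj1 hj7 hb' hpN hmin hcen hx
    have hxb := (minSet_shift_sub b hb hj1 hj7 hb' hmin hx).1
    rw [pw, pv, hcol x hxb y hy, sub_self, mul_zero]
  -- `4(A'B − AB')` is small
  have h4 : padicNorm p (2 * (2 * (A' * B - A * B'))) ≤ (p : ℚ) ^ (-(1 : ℤ)) := by
    have e : 2 * (2 * (A' * B - A * B')) = (GA' * GB - GA * GB') + GA' * (2 * B - GB) + (2 * A' - GA') * GB +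
        (2 * A' - GA') * (2 * B - GB) - GA * (2 * B' - GB') - (2 * A - GA) * GB' - (2 * A - GA) * (2 * B' - GB') := by ring
    rw [e, key, zero_add]
    have h1 : padicNorm p (GA' * (2 * B - GB)) ≤ (p : ℚ) ^ (-(1 : ℤ)) := CellA.small_mul iGA' dB
    have h2 : padicNorm p ((2 * A' - GA') * GB) ≤ (p : ℚ) ^ (-(1 : ℤ)) := by rw [mul_comm]; exact CellA.small_mul iGB dA'
    have h3 : padicNorm p ((2 * A' - GA') * (2 * B - GB)) ≤ (p : ℚ) ^ (-(1 : ℤ)) := CellA.small_mul (CellA.nI_of_small dA') dB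
    have h5 : padicNorm p (GA * (2 * B' - GB')) ≤ (p : ℚ) ^ (-(1 : ℤ)) := CellA.small_mul iGA dB'
    have h6 : padicNorm p ((2 * A - GA) * GB') ≤ (p : ℚ) ^ (-(1 : ℤ)) := by rw [mul_comm]; exact CellA.small_mul iGB' dA
    have h7 : padicNorm p ((2 * A - GA) * (2 * B' - GB')) ≤ (p : ℚ) ^ (-(1 : ℤ)) := CellA.small_mul (CellA.nI_of_small dA) dB'
    exact CellA.small_sub (CellA.small_sub (CellA.small_sub (CellA.small_add (CellA.small_add h1 h2) h3) h5) h6) h7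
  have hAB : padicNorm p (A' * B - A * B') ≤ (p : ℚ) ^ (-(1 : ℤ)) := small_of_two_mul hp5 (small_of_two_mul hp5 h4)
  -- the Casoratian
  have hcas : (-(p : ℚ)) ^ (-(2 * m + 3)) * casoratian b j = SW' * SV - SW * SV' := by
    have hp' : (-(p : ℚ)) ≠ 0 := neg_ne_zero.2 (Nat.cast_ne_zero.2 hp.out.ne_zero)
    have e2 : (-(p : ℚ)) ^ (-(2 * m + 3)) = (-(p : ℚ)) ^ (-(m + 3)) * (-(p : ℚ)) ^ (-m) := by
      rw [← zpow_add₀ hp']; ring_nf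
    rw [e2, casoratian]
    simp only [SW, SV, SW', SV', hb'def]; ring
  have hsmall : padicNorm p ((-(p : ℚ)) ^ (-(2 * m + 3)) * casoratian b j) ≤ (p : ℚ) ^ (-(1 : ℤ)) := by
    rw [hcas]
    have e : SW' * SV - SW * SV' = (A' * B - A * B') + A' * (SV - B) + (SW' - A') * B + (SW' - A') * (SV - B)
        - A * (SV' - B') - (SW - A) * B' - (SW - A) * (SV' - B') := by ring
    rw [e]
    have u1 : padicNorm p (A' * (SV - B)) ≤ (p : ℚ) ^ (-(1 : ℤ)) := CellA.small_mul iA' rV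
    have u2 : padicNorm p ((SW' - A') * B) ≤ (p : ℚ) ^ (-(1 : ℤ)) := by rw [mul_comm]; exact CellA.small_mul iB rW'
    have u3 : padicNorm p ((SW' - A') * (SV - B)) ≤ (p : ℚ) ^ (-(1 : ℤ)) := CellA.small_mul (CellA.nI_of_small rW') rV
    have u5 : padicNorm p (A * (SV' - B')) ≤ (p : ℚ) ^ (-(1 : ℤ)) := CellA.small_mul iA rV'
    have u6 : padicNorm p ((SW - A) * B') ≤ (p : ℚ) ^ (-(1 : ℤ)) := by rw [mul_comm]; exact CellA.small_mul iB' rW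
    have u7 : padicNorm p ((SW - A) * (SV' - B')) ≤ (p : ℚ) ^ (-(1 : ℤ)) := CellA.small_mul (CellA.nI_of_small rW) rV'
    exact CellA.small_sub (CellA.small_sub (CellA.small_sub (CellA.small_add (CellA.small_add (CellA.small_add hAB u1) u2) u3)
      u5) u6) u7
  have := val_ge_of_normalised (k := 1) hne hsmall
  linarith

include hb hj1 hj7 hb' hp5 hwin hpN hm hmin hcen in
/-- **ZERO CELLS (double drop)**: if all pair vectors of the level-`m` classes vanish, then `v_p(Cas_j(b)) ≥ (3 + 2m) + 2`. -/
theorem zero_bound (hzero : ∀ x ∈ (Finset.filter (fun x => classExp b p x = m) (Finset.range p)), (wHat b p x + (-1 : ℚ) ^ (m + 1) * wHat b p (conjClass b p x)) = 0 ∧ (vHat b p x + (-1 : ℚ) ^ (m + 1) * vHat b p (conjClass b p x)) = 0)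
    (hne : casoratian b j ≠ 0) : 3 + 2 * m + 2 ≤ padicValRat p (casoratian b j) := by
  set b' := shift b j with hb'def
  have hwin' : (b' 0 + 2 : ℤ) < (p : ℤ) ^ 2 := by rw [hb'def, shift_zero b hj1]; exact hwin
  have hpN' : p ≤ (b' 0).toNat := by rw [hb'def, shift_zero b hj1]; exact hpN
  have hmin' : ∀ x, x < p → m ≤ classExp b' p x := fun x hx => (hmin x hx).trans (classExp_shift_ge b hb.1 hj1 p x)
  have hcen' : ∀ x, x < p → classExp b' p x = m → ¬ CentreIn b' p x := by
    intro x hx hE h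
    have hxb := (minSet_shift_sub b hb hj1 hj7 hb' hmin (mem_minSet.2 ⟨hx, hE⟩)).1
    exact hcen x hx (mem_minSet.1 hxb).2 ((centreIn_shift b hj1 p x).1 h)
  have hzero' : ∀ x ∈ (Finset.filter (fun x => classExp b' p x = m) (Finset.range p)), (wHat b' p x + (-1 : ℚ) ^ (m + 1) * wHat b' p (conjClass b' p x)) = 0 ∧ (vHat b' p x + (-1 : ℚ) ^ (m + 1) * vHat b' p (conjClass b' p x)) = 0 := by
    intro x hx
    obtain ⟨pw, pv⟩ := pair_shift_eq b hb hj1 hj7 hb' hpN hmin hcen hx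
    have hxb := (minSet_shift_sub b hb hj1 hj7 hb' hmin hx).1
    rw [pw, pv]; exact hzero x hxb
  obtain ⟨-, -, dA, dB, -, -⟩ := block_digits b hb hp5 hwin hpN hm hcen
  obtain ⟨-, -, dA', dB', -, -⟩ := block_digits b' hb' hp5 hwin' hpN' hm hcen'
  obtain ⟨rW, rV⟩ := full_split b hb hp5 hwin hm hmin
  obtain ⟨rW', rV'⟩ := full_split b' hb' hp5 hwin' hm hmin'
  have GA0 : ∑ x ∈ (Finset.filter (fun x => classExp b p x = m) (Finset.range p)), gHat b p x * (wHat b p x + (-1 : ℚ) ^ (m + 1) * wHat b p (conjClass b p x)) = 0 :=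
    sum_eq_zero fun x hx => by rw [(hzero x hx).1, mul_zero]
  have GB0 : ∑ x ∈ (Finset.filter (fun x => classExp b p x = m) (Finset.range p)), gHat b p x * (vHat b p x + (-1 : ℚ) ^ (m + 1) * vHat b p (conjClass b p x)) = 0 :=
    sum_eq_zero fun x hx => by rw [(hzero x hx).2, mul_zero]
  have GA0' : ∑ x ∈ (Finset.filter (fun x => classExp b' p x = m) (Finset.range p)), gHat b' p x * (wHat b' p x + (-1 : ℚ) ^ (m + 1) * wHat b' p (conjClass b' p x)) = 0 :=
    sum_eq_zero fun x hx => by rw [(hzero' x hx).1, mul_zero]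
  have GB0' : ∑ x ∈ (Finset.filter (fun x => classExp b' p x = m) (Finset.range p)), gHat b' p x * (vHat b' p x + (-1 : ℚ) ^ (m + 1) * vHat b' p (conjClass b' p x)) = 0 :=
    sum_eq_zero fun x hx => by rw [(hzero' x hx).2, mul_zero]
  rw [GA0, sub_zero] at dA
  rw [GB0, sub_zero] at dB
  rw [GA0', sub_zero] at dA'
  rw [GB0', sub_zero] at dB'
  have sA := small_of_two_mul hp5 dA
  have sB := small_of_two_mul hp5 dB
  have sA' := small_of_two_mul hp5 dA'
  have sB' := small_of_two_mul hp5 dB'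
  set A := ∑ x ∈ (Finset.filter (fun x => classExp b p x = m) (Finset.range p)), ((-(p : ℚ)) ^ (-(m + 3)) * classW b p x)
  set B := ∑ x ∈ (Finset.filter (fun x => classExp b p x = m) (Finset.range p)), ((-(p : ℚ)) ^ (-m) * classV b p x)
  set A' := ∑ x ∈ (Finset.filter (fun x => classExp b' p x = m) (Finset.range p)), ((-(p : ℚ)) ^ (-(m + 3)) * classW b' p x)
  set B' := ∑ x ∈ (Finset.filter (fun x => classExp b' p x = m) (Finset.range p)), ((-(p : ℚ)) ^ (-m) * classV b' p x)
  set SW := (-(p : ℚ)) ^ (-(m + 3)) * coeffW b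
  set SV := (-(p : ℚ)) ^ (-m) * coeffV b
  set SW' := (-(p : ℚ)) ^ (-(m + 3)) * coeffW b'
  set SV' := (-(p : ℚ)) ^ (-m) * coeffV b'
  have tW : padicNorm p SW ≤ (p : ℚ) ^ (-(1 : ℤ)) := by
    have e : SW = (SW - A) + A := by ring
    rw [e]; exact CellA.small_add rW sA
  have tV : padicNorm p SV ≤ (p : ℚ) ^ (-(1 : ℤ)) := by
    have e : SV = (SV - B) + B := by ring
    rw [e]; exact CellA.small_add rV sB
  have tW' : padicNorm p SW' ≤ (p : ℚ) ^ (-(1 : ℤ)) := by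
    have e : SW' = (SW' - A') + A' := by ring
    rw [e]; exact CellA.small_add rW' sA'
  have tV' : padicNorm p SV' ≤ (p : ℚ) ^ (-(1 : ℤ)) := by
    have e : SV' = (SV' - B') + B' := by ring
    rw [e]; exact CellA.small_add rV' sB'
  have hcas : (-(p : ℚ)) ^ (-(2 * m + 3)) * casoratian b j = SW' * SV - SW * SV' := by
    have hp' : (-(p : ℚ)) ≠ 0 := neg_ne_zero.2 (Nat.cast_ne_zero.2 hp.out.ne_zero)
    have e2 : (-(p : ℚ)) ^ (-(2 * m + 3)) = (-(p : ℚ)) ^ (-(m + 3)) * (-(p : ℚ)) ^ (-m) := by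
      rw [← zpow_add₀ hp']; ring_nf
    rw [e2, casoratian]
    simp only [SW, SV, SW', SV', hb'def]; ring
  have hsmall : padicNorm p ((-(p : ℚ)) ^ (-(2 * m + 3)) * casoratian b j) ≤ (p : ℚ) ^ (-(2 : ℤ)) := by
    rw [hcas]
    exact (padicNorm.sub (p := p)).trans (max_le (small_mul_small tW' tV) (small_mul_small tW tV'))
  have := val_ge_of_normalised (k := 2) hne hsmall
  linarith

include hb hp5 hwin hpN hm hmin hcen in
/-- **ZERO CELLS, the digit-free content**: `v_p(W(b)) ≥ m + 4` and `v_p(V(b)) ≥ m + 1`. -/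
theorem zero_bound_WV (hzero : ∀ x ∈ (Finset.filter (fun x => classExp b p x = m) (Finset.range p)), (wHat b p x + (-1 : ℚ) ^ (m + 1) * wHat b p (conjClass b p x)) = 0 ∧ (vHat b p x + (-1 : ℚ) ^ (m + 1) * vHat b p (conjClass b p x)) = 0) :
    (coeffW b ≠ 0 → m + 4 ≤ padicValRat p (coeffW b)) ∧ (coeffV b ≠ 0 → m + 1 ≤ padicValRat p (coeffV b)) := by
  obtain ⟨-, -, dA, dB, -, -⟩ := block_digits b hb hp5 hwin hpN hm hcen
  obtain ⟨rW, rV⟩ := full_split b hb hp5 hwin hm hmin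
  have GA0 : ∑ x ∈ (Finset.filter (fun x => classExp b p x = m) (Finset.range p)), gHat b p x * (wHat b p x + (-1 : ℚ) ^ (m + 1) * wHat b p (conjClass b p x)) = 0 :=
    sum_eq_zero fun x hx => by rw [(hzero x hx).1, mul_zero]
  have GB0 : ∑ x ∈ (Finset.filter (fun x => classExp b p x = m) (Finset.range p)), gHat b p x * (vHat b p x + (-1 : ℚ) ^ (m + 1) * vHat b p (conjClass b p x)) = 0 :=
    sum_eq_zero fun x hx => by rw [(hzero x hx).2, mul_zero]
  rw [GA0, sub_zero] at dA
  rw [GB0, sub_zero] at dB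
  have sA := small_of_two_mul hp5 dA
  have sB := small_of_two_mul hp5 dB
  have tW : padicNorm p ((-(p : ℚ)) ^ (-(m + 3)) * coeffW b) ≤ (p : ℚ) ^ (-(1 : ℤ)) := by
    have e : (-(p : ℚ)) ^ (-(m + 3)) * coeffW b =
        ((-(p : ℚ)) ^ (-(m + 3)) * coeffW b - ∑ x ∈ (Finset.filter (fun x => classExp b p x = m) (Finset.range p)), ((-(p : ℚ)) ^ (-(m + 3)) * classW b p x)) + ∑ x ∈ (Finset.filter (fun x => classExp b p x = m) (Finset.range p)), ((-(p : ℚ)) ^ (-(m + 3)) * classW b p x) := by ring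
    rw [e]; exact CellA.small_add rW sA
  have tV : padicNorm p ((-(p : ℚ)) ^ (-m) * coeffV b) ≤ (p : ℚ) ^ (-(1 : ℤ)) := by
    have e : (-(p : ℚ)) ^ (-m) * coeffV b =
        ((-(p : ℚ)) ^ (-m) * coeffV b - ∑ x ∈ (Finset.filter (fun x => classExp b p x = m) (Finset.range p)), ((-(p : ℚ)) ^ (-m) * classV b p x)) + ∑ x ∈ (Finset.filter (fun x => classExp b p x = m) (Finset.range p)), ((-(p : ℚ)) ^ (-m) * classV b p x) := by ring
    rw [e]; exact CellA.small_add rV sB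
  refine ⟨fun hW => ?_, fun hV => ?_⟩
  · have := val_ge_of_normalised (k := 1) hW tW; linarith
  · have := val_ge_of_normalised (k := 1) hV tV; linarith

end Main

end Summit.KontsevichZagierPeriods.Zeta5Search.CellKit

end
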